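import Literature.Topology.FourManifolds.NonSeparatingSpheresSideFunction
import HarnessLib

/-!
# Budney–Gabai Thm. 3.13: the lift of a non-separating sphere separates the ends of the
# cyclic cover

Companion to `NonSeparatingSpheresCover.lean` (the cyclic cover
`π = exp × id : ℝ × Sⁿ → S¹ × Sⁿ` and the lift `ẽ : Sⁿ → ℝ × Sⁿ` of a smoothly embedded `n`-sphere
`e`, whose deck translates `τₘ ẽ(Sⁿ)`, `m ≠ 0`, are disjoint from it) and
`NonSeparatingSpheresSideFunction.lean` (a defining function `G` of `ẽ(Sⁿ)` with eventually
constant signs `σ₊`, `σ₋` towards the two ends of the cylinder), for the fact seat of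
`Literature.Topology.FourManifolds.BudneyGabai2019_thm_3_13` (R. Budney, D. Gabai, *Knotted
3-balls in `S⁴`*, arXiv:1912.09029, Thm. 3.13: `Diff(S¹ × Sⁿ)` acts transitively on the
non-separating `n`-spheres of `S¹ × Sⁿ`).

Both the classical argument (`n ≤ 2`: cut `S¹ × Sⁿ` open along the sphere and recognise a
cylinder `Sⁿ × [0, 1]`) and the printed proof for `n ≥ 3` (p. 22: the dual circle of a
non-separating sphere is isotoped onto `S¹ × {*}`, which needs its degree over `S¹` to be `±1`)
rest on one topological fact that the source does not spell out: **if the sphere `K = e(Sⁿ)` does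
not separate `S¹ × Sⁿ`, then its lift `K̃ = ẽ(Sⁿ)` separates the two ends of the cylinder
`ℝ × Sⁿ`** — equivalently, no complementary component of `K̃` is bounded in the `ℝ`-direction;
equivalently, the signs `σ₊`, `σ₋` of a defining function of `K̃` at the two ends are opposite.
This file proves it, in three layers.

* §1 `PeriodicSeparation.false_of_bddComponent` — an abstract **`ℤ`-periodic separation
  lemma**: let `ℤ` act on a connected, locally connected Hausdorff space `Z` by homeomorphisms
  `T j`, with a proper continuous height `h`, `h ∘ T j = h + j`, without local maxima; let
  `K ⊆ Z` be compact and connected with `K ∩ T j K = ∅` for `j ≠ 0`, and suppose the deck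
  transformations act transitively on the components of the complement of `⋃ⱼ T j K` (which is
  what "the image of `K` in the quotient does not separate" means upstairs).  Then no connected
  component of `Z ∖ K` is `h`-bounded.  Proof: the bounded complementary component `B` and its
  translates `Bⱼ = T j B` form a laminar family (two translates are nested or disjoint — an
  edge-point argument using the maximum of `h` on `B̄ⱼ`, which lies on `T j K`); a minimal
  translate `V` among the finitely many inside `B` is a full component of the complement of
  `⋃ⱼ T j K`, so by transitivity the translates of the compact set `V ∪ T j₀ K` tile `Z`; a
  locally finite partition of the connected `Z` into compact pieces is absurd.
* §2 `Cylinder.exists_deck_mem_connectedComponentIn` — **deck transitivity for the cylinder**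
  `exp × id : ℝ × Y → S¹ × Y`: two points of the preimage of a path connected set `U` are, up to
  a deck translation `(t, y) ↦ (t + 2πm, y)`, in the same component of the preimage (lift a path
  of `U` through the covering `exp : ℝ → S¹`, Mathlib's `IsCoveringMap.liftPath`; Hatcher,
  *Algebraic Topology*, Prop. 1.30), and `Cylinder.false_of_bddComponent`, the periodic
  separation lemma for the cylinder over a compact, connected, locally path connected `Y`.
* §3 the sphere: for a smooth embedding `e : Sⁿ → S¹ × Sⁿ` (`n ≥ 1`) with connected complement
  and a lift `ẽ` (`(exp × id) ∘ ẽ = e`),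
  `BudneyGabai2019_thm_3_13.not_bdd_connectedComponentIn_compl_range_lift` — **no complementary
  component of `ẽ(Sⁿ)` in `ℝ × Sⁿ` is bounded in `t`**;
  `BudneyGabai2019_thm_3_13.false_of_sublevel_bdd` — a continuous function `G` on the cylinder
  vanishing exactly on `ẽ(Sⁿ)` has no nonempty `t`-bounded strict side `{σ G < 0}`;
  `BudneyGabai2019_thm_3_13.sideFunction_signs_mul_neg` — hence **the two end signs of the
  defining function of `NonSeparatingSpheresSideFunction.exists_sideFunction` are opposite,
  `σ₊ σ₋ < 0`** (the nonempty side is produced from the regularity `dG ≠ 0` along `ẽ(Sⁿ)`);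
  and `BudneyGabai2019_thm_3_13.exists_sideFunction_separating` — the defining function
  renormalised to be positive towards `+∞` and negative towards `-∞`.

Everything here is proved; no definition and no named fact is introduced.  §0 records that a
product of two locally path connected spaces is locally path connected (used for `S¹ × Sⁿ` and
`ℝ × Sⁿ`; Mathlib has the notion but not the product instance).

## References

* R. Budney, D. Gabai, *Knotted 3-balls in `S⁴`*, arXiv:1912.09029 (v2), §3, Thm. 3.13 and its
  proof (p. 22). [BudneyGabai2019]
* A. Hatcher, *Algebraic Topology*, CUP (2002), §1.3, Props. 1.30–1.34 (path lifting, deck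
  transformations of `ℝ → S¹`). [HatcherAT2002]
-/

noncomputable section

open scoped Manifold ContDiff Topology Real
open Set Function Metric Filter

namespace Literature.Topology.FourManifolds

/-! ### §0 Products of locally path connected spaces -/

/-- **A product of two locally path connected spaces is locally path connected** (products of
path connected neighbourhoods form neighbourhood bases). [folklore] -/
theorem locallyPathConnectedSpace_prod {X Y : Type*} [TopologicalSpace X] [TopologicalSpace Y]
    [LocallyPathConnectedSpace X] [LocallyPathConnectedSpace Y] :
    LocallyPathConnectedSpace (X × Y) :=
  .of_bases (fun p ↦ (LocallyPathConnectedSpace.path_connected_basis p.1).prod_nhds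
      (LocallyPathConnectedSpace.path_connected_basis p.2))
    fun _ _ hi ↦ hi.1.2.prod hi.2.2

/-! ### §1 The `ℤ`-periodic separation lemma -/

namespace PeriodicSeparation

variable {Z : Type*} [TopologicalSpace Z]

/-- Dichotomy: a preconnected set disjoint from `S` lies in one of the two open pieces `A`, `B`
of `Sᶜ`. [folklore] -/
theorem subset_or_subset {S S' A B : Set Z} (hA : IsOpen A) (hB : IsOpen B)
    (hAB : Disjoint A B) (hcover : A ∪ B = Sᶜ) (hS' : IsPreconnected S') (hSS' : Disjoint S' S) :
    S' ⊆ A ∨ S' ⊆ B :=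
  hS'.subset_or_subset hA hB hAB (by rw [hcover]; exact subset_compl_iff_disjoint_right.2 hSS')

/-- Edge points: in a preconnected space, a nonempty open set `B ≠ univ` whose closure stays in
`B ∪ S` has a closure point on `S`. [folklore] -/
theorem exists_mem_closure_inter [PreconnectedSpace Z] {S B : Set Z} (hB : IsOpen B)
    (hBne : B.Nonempty) (hBuniv : B ≠ univ) (hcl : closure B ⊆ B ∪ S) :
    ∃ p ∈ closure B, p ∈ S := by
  have hncl : ¬ IsClosed B := fun h ↦ hBuniv (IsClopen.eq_univ ⟨h, hB⟩ hBne)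
  obtain ⟨p, hp, hpB⟩ : ∃ p ∈ closure B, p ∉ B := by
    by_contra h
    push Not at h
    exact hncl (closure_subset_iff_isClosed.1 fun p hp ↦ h p hp)
  exact ⟨p, hp, (hcl hp).resolve_left hpB⟩

/-- The maximum argument: if `S' ⊆ B` for an open `B` with compact closure contained in `B ∪ S`,
and the height `h` has no local maxima, then every point of `S'` lies strictly below some point
of `S` (the maximum of `h` on `B̄` is attained on `S`). [folklore] -/
theorem exists_lt_of_subset {S S' B : Set Z} {h : Z → ℝ} (hh : Continuous h)
    (hup : ∀ z, ∀ U ∈ 𝓝 z, ∃ z' ∈ U, h z < h z')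
    (hB : IsOpen B) (hcl : closure B ⊆ B ∪ S) (hcpt : IsCompact (closure B))
    (hS'B : S' ⊆ B) {q : Z} (hq : q ∈ S') : ∃ p ∈ S, h q < h p := by
  obtain ⟨q', hq'B, hqq'⟩ := hup q B (hB.mem_nhds (hS'B hq))
  obtain ⟨p₀, hp₀, hmax⟩ := hcpt.exists_isMaxOn ⟨q', subset_closure hq'B⟩ hh.continuousOn
  have hp₀B : p₀ ∉ B := by
    intro hp₀B
    obtain ⟨p', hp'B, hp'⟩ := hup p₀ B (hB.mem_nhds hp₀B)
    exact (not_le.2 hp') (hmax (subset_closure hp'B))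
  exact ⟨p₀, (hcl hp₀).resolve_left hp₀B, hqq'.trans_le (hmax (subset_closure hq'B))⟩

/-- No mutual nesting: two compact pieces `S₁ ⊆ B₂` and `S₂ ⊆ B₁` cannot each lie in the other's
bounded side (compare the maxima of the height). [folklore] -/
theorem not_subset_and_subset {S₁ S₂ B₁ B₂ : Set Z} {h : Z → ℝ} (hh : Continuous h)
    (hup : ∀ z, ∀ U ∈ 𝓝 z, ∃ z' ∈ U, h z < h z')
    (hB₁ : IsOpen B₁) (hcl₁ : closure B₁ ⊆ B₁ ∪ S₁) (hcpt₁ : IsCompact (closure B₁))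
    (hB₂ : IsOpen B₂) (hcl₂ : closure B₂ ⊆ B₂ ∪ S₂) (hcpt₂ : IsCompact (closure B₂))
    (hS₁ : IsCompact S₁) (hS₁ne : S₁.Nonempty)
    (h₁₂ : S₁ ⊆ B₂) (h₂₁ : S₂ ⊆ B₁) : False := by
  obtain ⟨q, hq, hqmax⟩ := hS₁.exists_isMaxOn hS₁ne hh.continuousOn
  obtain ⟨p, hp, hqp⟩ := exists_lt_of_subset hh hup hB₂ hcl₂ hcpt₂ h₁₂ hq
  obtain ⟨q', hq', hpq'⟩ := exists_lt_of_subset hh hup hB₁ hcl₁ hcpt₁ h₂₁ hp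
  exact (lt_irrefl _) ((hqp.trans hpq').trans_le (hqmax hq'))

/-- Laminarity: if the piece `S₁` lies in the bounded side `B₂` of `S₂`, then so does its own
bounded side `B₁`. [folklore] -/
theorem subset_of_subset [PreconnectedSpace Z] {S₁ S₂ A₁ B₁ A₂ B₂ : Set Z} {h : Z → ℝ}
    (hh : Continuous h) (hup : ∀ z, ∀ U ∈ 𝓝 z, ∃ z' ∈ U, h z < h z')
    (hA₁ : IsOpen A₁) (hB₁ : IsOpen B₁) (hAB₁ : Disjoint A₁ B₁) (hcov₁ : A₁ ∪ B₁ = S₁ᶜ)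
    (hA₂ : IsOpen A₂) (hB₂ : IsOpen B₂) (hAB₂ : Disjoint A₂ B₂) (hcov₂ : A₂ ∪ B₂ = S₂ᶜ)
    (hcl₁ : closure B₁ ⊆ B₁ ∪ S₁) (hcpt₁ : IsCompact (closure B₁))
    (hcl₂ : closure B₂ ⊆ B₂ ∪ S₂) (hcpt₂ : IsCompact (closure B₂))
    (hS₁ : IsCompact S₁) (hS₁c : IsConnected S₁) (hS₂c : IsConnected S₂)
    (hS : Disjoint S₁ S₂) (hB₁c : IsConnected B₁) (hB₁univ : B₁ ≠ univ)
    (h₁₂ : S₁ ⊆ B₂) : B₁ ⊆ B₂ := by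
  -- `S₂ ⊆ A₁`: the alternative `S₂ ⊆ B₁` is excluded by `not_subset_and_subset`
  have hS₂A₁ : S₂ ⊆ A₁ := by
    rcases subset_or_subset hA₁ hB₁ hAB₁ hcov₁ hS₂c.isPreconnected hS.symm with h | h
    · exact h
    · exact (not_subset_and_subset hh hup hB₁ hcl₁ hcpt₁ hB₂ hcl₂ hcpt₂ hS₁ hS₁c.nonempty
        h₁₂ h).elim
  have hB₁S₂ : Disjoint B₁ S₂ := hAB₁.symm.mono_right hS₂A₁
  rcases subset_or_subset hA₂ hB₂ hAB₂ hcov₂ hB₁c.isPreconnected hB₁S₂ with h | h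
  · -- `B₁ ⊆ A₂` is impossible: an edge point of `B₁` lies on `S₁ ⊆ B₂`, off `closure A₂`
    exfalso
    obtain ⟨p, hp, hpS₁⟩ := exists_mem_closure_inter hB₁ hB₁c.nonempty hB₁univ hcl₁
    have hd : Disjoint (closure A₂) B₂ := hAB₂.closure_left hB₂
    exact hd.ne_of_mem (closure_mono h hp) (h₁₂ hpS₁) rfl
  · exact h

/-- Disjointness: if each of two pieces misses the other's bounded side, the two bounded sides
are disjoint. [folklore] -/
theorem disjoint_of_disjoint [PreconnectedSpace Z] {S₁ S₂ A₁ B₁ B₂ : Set Z}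
    (hA₁ : IsOpen A₁) (hB₁ : IsOpen B₁) (hAB₁ : Disjoint A₁ B₁) (hcov₁ : A₁ ∪ B₁ = S₁ᶜ)
    (hcl₁ : closure B₁ ⊆ B₁ ∪ S₁)
    (hB₂ : IsOpen B₂) (hB₂c : IsConnected B₂) (hB₂univ : B₂ ≠ univ)
    (hcl₂ : closure B₂ ⊆ B₂ ∪ S₂)
    (hS : Disjoint S₁ S₂) (h₁ : Disjoint S₂ B₁) (h₂ : Disjoint S₁ B₂) : Disjoint B₁ B₂ := by
  rcases subset_or_subset hA₁ hB₁ hAB₁ hcov₁ hB₂c.isPreconnected h₂.symm with h | h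
  · exact hAB₁.symm.mono_right h
  · exfalso
    obtain ⟨p, hp, hpS₂⟩ := exists_mem_closure_inter hB₂ hB₂c.nonempty hB₂univ hcl₂
    rcases hcl₁ (closure_mono h hp) with hpB₁ | hpS₁
    · exact h₁.ne_of_mem hpS₂ hpB₁ rfl
    · exact hS.ne_of_mem hpS₁ hpS₂ rfl

/-- **The `ℤ`-periodic separation lemma.**  Let `ℤ` act on the connected, locally connected
Hausdorff space `Z` by homeomorphisms `T j` (`T 0 = id`, `T (i + j) = T i ∘ T j`), let
`h : Z → ℝ` be continuous and proper (`h⁻¹[a, b]` compact) with `h ∘ T j = h + j` and without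
local maxima, and let `K ⊆ Z` be compact and connected with `K ∩ T j K = ∅` for `j ≠ 0`.  If the
deck transformations act transitively on the components of the complement of `⋃ⱼ T j K` — for
a regular covering `Z → Z/ℤ` this says that the image of `K` does not separate the quotient —
then **no connected component of `Z ∖ K` is `h`-bounded**.  (For `Z = ℝ × Sⁿ → S¹ × Sⁿ` and `K`
the lift of a non-separating `n`-sphere: the lift separates the two ends of the cylinder; the
topological input of Budney–Gabai's proof of Thm. 3.13, p. 22.) [folklore] -/
theorem false_of_bddComponent [T2Space Z] [ConnectedSpace Z] [LocallyConnectedSpace Z]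
    (T : ℤ → Z ≃ₜ Z) (hT0 : ∀ z, T 0 z = z) (hTadd : ∀ i j z, T (i + j) z = T i (T j z))
    (h : Z → ℝ) (hh : Continuous h) (hhT : ∀ j z, h (T j z) = h z + j)
    (hup : ∀ z, ∀ U ∈ 𝓝 z, ∃ z' ∈ U, h z < h z')
    (hprop : ∀ a b, IsCompact (h ⁻¹' Icc a b))
    {K : Set Z} (hK : IsCompact K) (hKc : IsConnected K)
    (hdisj : ∀ j ≠ 0, Disjoint K (T j '' K))
    (htrans : ∀ x ∈ (⋃ j, T j '' K)ᶜ, ∀ y ∈ (⋃ j, T j '' K)ᶜ,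
      ∃ j, T j y ∈ connectedComponentIn (⋃ j, T j '' K)ᶜ x)
    {x : Z} (hx : x ∉ K) {a b : ℝ} (hbdd : connectedComponentIn Kᶜ x ⊆ h ⁻¹' Icc a b) :
    False := by
  -- ### the action
  have hTneg : ∀ j z, T (-j) (T j z) = z := fun j z ↦ by rw [← hTadd, neg_add_cancel, hT0]
  have himage : ∀ i j (s : Set Z), T i '' (T j '' s) = T (i + j) '' s := fun i j s ↦ by
    rw [image_image]
    exact image_congr fun z _ ↦ (hTadd i j z).symm
  have hT0' : ((T 0 : Z ≃ₜ Z) : Z → Z) = id := funext hT0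
  have hunbdd : ∀ c : ℝ, ∃ z : Z, c < h z := fun c ↦ by
    refine ⟨T (⌈c - h x⌉ + 1) x, ?_⟩
    rw [hhT]
    push_cast
    have := Int.le_ceil (c - h x)
    linarith
  -- ### the bounded component `B` and the rest `A` of `Kᶜ`
  set U : Set Z := (⋃ j, T j '' K)ᶜ with hU
  set B : Set Z := connectedComponentIn Kᶜ x with hB
  have hKcl : IsClosed K := hK.isClosed
  have hxB : x ∈ B := mem_connectedComponentIn hx
  have hBsub : B ⊆ Kᶜ := connectedComponentIn_subset _ _
  have hBopen : IsOpen B := hKcl.isOpen_compl.connectedComponentIn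
  have hBconn : IsConnected B := isConnected_connectedComponentIn_iff.2 hx
  set A : Set Z := Kᶜ \ B with hA
  have hAopen : IsOpen A := by
    rw [isOpen_iff_forall_mem_open]
    intro y hy
    refine ⟨connectedComponentIn Kᶜ y, fun z hz ↦ ⟨connectedComponentIn_subset _ _ hz,
      fun hzB ↦ hy.2 ?_⟩, hKcl.isOpen_compl.connectedComponentIn, mem_connectedComponentIn hy.1⟩
    have h1 : connectedComponentIn Kᶜ y = connectedComponentIn Kᶜ z := connectedComponentIn_eq hz
    have h2 : B = connectedComponentIn Kᶜ z := connectedComponentIn_eq hzB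
    rw [h2, ← h1]
    exact mem_connectedComponentIn hy.1
  have hAB : Disjoint A B := disjoint_sdiff_left
  have hcov : A ∪ B = Kᶜ := by rw [hA, Set.sdiff_union_of_subset hBsub]
  have hcl : closure B ⊆ B ∪ K := by
    have h1 : Disjoint (closure B) A := hAB.symm.closure_left hAopen
    intro z hz
    by_cases hzK : z ∈ K
    · exact Or.inr hzK
    · have hz' : z ∈ A ∪ B := by rw [hcov]; exact hzK
      exact hz'.elim (fun hzA ↦ (h1.ne_of_mem hz hzA rfl).elim) Or.inl
  have hBne_univ : B ≠ univ := by
    intro hBu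
    obtain ⟨z, hz⟩ := hunbdd b
    have : z ∈ h ⁻¹' Icc a b := hbdd (hBu ▸ mem_univ z)
    exact (not_le.2 hz) this.2
  -- ### the translates `S j = T j K`, `Bj j = T j B`, `Aj j = T j A`
  set S : ℤ → Set Z := fun j ↦ T j '' K with hS
  set Bj : ℤ → Set Z := fun j ↦ T j '' B with hBj
  set Aj : ℤ → Set Z := fun j ↦ T j '' A with hAj
  have hSc : ∀ j, IsCompact (S j) := fun j ↦ hK.image (T j).continuous
  have hSconn : ∀ j, IsConnected (S j) := fun j ↦ hKc.image _ (T j).continuous.continuousOn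
  have hScl : ∀ j, IsClosed (S j) := fun j ↦ (hSc j).isClosed
  have hBjo : ∀ j, IsOpen (Bj j) := fun j ↦ (T j).isOpen_image.2 hBopen
  have hAjo : ∀ j, IsOpen (Aj j) := fun j ↦ (T j).isOpen_image.2 hAopen
  have hABj : ∀ j, Disjoint (Aj j) (Bj j) := fun j ↦ (disjoint_image_iff (T j).injective).2 hAB
  have hcovj : ∀ j, Aj j ∪ Bj j = (S j)ᶜ := fun j ↦ by
    simp only [hAj, hBj, hS, ← image_union, hcov, image_compl_eq (T j).bijective]
  have hBjc : ∀ j, IsConnected (Bj j) := fun j ↦ hBconn.image _ (T j).continuous.continuousOn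
  have hclj : ∀ j, closure (Bj j) ⊆ Bj j ∪ S j := fun j ↦ by
    simp only [hBj, hS, ← (T j).image_closure, ← image_union]
    exact image_mono hcl
  have hBjbdd : ∀ j, Bj j ⊆ h ⁻¹' Icc (a + j) (b + j) := fun j ↦ by
    rintro _ ⟨z, hz, rfl⟩
    have h1 := hbdd hz
    simp only [mem_preimage, mem_Icc, hhT] at h1 ⊢
    constructor <;> linarith [h1.1, h1.2]
  have hcptj : ∀ j, IsCompact (closure (Bj j)) := fun j ↦
    (hprop _ _).of_isClosed_subset isClosed_closure
      (closure_minimal (hBjbdd j) (isClosed_Icc.preimage hh))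
  have hBjuniv : ∀ j, Bj j ≠ univ := fun j hju ↦ by
    obtain ⟨z, hz⟩ := hunbdd (b + j)
    have h1 := hBjbdd j (hju ▸ mem_univ z)
    exact (not_le.2 hz) h1.2
  have hSdisj : ∀ i j, i ≠ j → Disjoint (S i) (S j) := fun i j hij ↦ by
    have h1 : S j = T i '' (T (j - i) '' K) := by rw [himage, add_sub_cancel]
    rw [h1]
    exact (disjoint_image_iff (T i).injective).2 (hdisj (j - i) (sub_ne_zero.2 (Ne.symm hij)))
  have hSB : ∀ j, Disjoint (S j) (Bj j) := fun j ↦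
    (disjoint_image_iff (T j).injective).2 (disjoint_compl_right.mono_right hBsub)
  -- ### laminarity of the family `Bj`
  have hlam : ∀ i j, i ≠ j → S i ⊆ Bj j → Bj i ⊆ Bj j := fun i j hij hsub ↦
    subset_of_subset hh hup (hAjo i) (hBjo i) (hABj i) (hcovj i) (hAjo j) (hBjo j) (hABj j)
      (hcovj j) (hclj i) (hcptj i) (hclj j) (hcptj j) (hSc i) (hSconn i) (hSconn j)
      (hSdisj i j hij) (hBjc i) (hBjuniv i) hsub
  -- ### the finitely many translates inside `B`, and a minimal one `V = Bj j₀`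
  set J : Set ℤ := {j | Bj j ⊆ B} with hJ
  have h0J : (0 : ℤ) ∈ J := by
    show T 0 '' B ⊆ B
    rw [hT0', image_id]
  have hJfin : J.Finite := by
    refine (finite_Icc (⌈a - b⌉) (⌊b - a⌋)).subset fun j hj ↦ ?_
    have h1 : T j x ∈ B := hj ⟨x, hxB, rfl⟩
    have h2 := hbdd h1
    have h3 := hbdd hxB
    simp only [mem_preimage, mem_Icc, hhT] at h2 h3
    exact ⟨Int.ceil_le.2 (by linarith), Int.le_floor.2 (by linarith)⟩
  obtain ⟨j₀, hj₀J, hmin⟩ := hJfin.exists_minimalFor Bj J ⟨0, h0J⟩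
  have hVB : Bj j₀ ⊆ B := hj₀J
  -- `V = Bj j₀` misses every translate `S m`
  have hSV : ∀ m, m ≠ j₀ → Disjoint (S m) (Bj j₀) := fun m hm ↦ by
    rcases subset_or_subset (hAjo j₀) (hBjo j₀) (hABj j₀) (hcovj j₀) (hSconn m).isPreconnected
      (hSdisj m j₀ hm) with h1 | h1
    · exact (hABj j₀).mono_left h1
    · exfalso
      have h2 : Bj m ⊆ Bj j₀ := hlam m j₀ hm h1
      have h3 : Bj j₀ ⊆ Bj m := hmin (h2.trans hVB) h2
      obtain ⟨s, hs⟩ := (hSconn m).nonempty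
      exact (hSB m).ne_of_mem hs (h3 (h1 hs)) rfl
  have hVU : Bj j₀ ⊆ U := by
    intro z hz
    simp only [hU, mem_compl_iff, mem_iUnion, not_exists]
    intro m hzm
    rcases eq_or_ne m j₀ with rfl | hm
    · exact (hSB _).ne_of_mem hzm hz rfl
    · exact (hSV m hm).ne_of_mem hzm hz rfl
  -- `V` is a full component of `U`
  have hvV : T j₀ x ∈ Bj j₀ := ⟨x, hxB, rfl⟩
  have hclV : closure (Bj j₀) ⊆ Bj j₀ ∪ S j₀ := hclj j₀
  have hVcomp : connectedComponentIn U (T j₀ x) = Bj j₀ := by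
    apply Subset.antisymm
    · refine isPreconnected_connectedComponentIn.subset_left_of_subset_union
        (u := Bj j₀) (v := (closure (Bj j₀))ᶜ) (hBjo j₀) isClosed_closure.isOpen_compl
        (disjoint_compl_right.mono_right (compl_subset_compl.2 subset_closure)) ?_
        ⟨T j₀ x, mem_connectedComponentIn (hVU hvV), hvV⟩
      · intro z hz
        by_cases hzc : z ∈ closure (Bj j₀)
        · refine Or.inl ((hclV hzc).resolve_right fun hzS ↦ ?_)
          have hzU : z ∈ U := connectedComponentIn_subset _ _ hz
          simp only [hU, mem_compl_iff, mem_iUnion, not_exists] at hzU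
          exact hzU j₀ hzS
        · exact Or.inr hzc
    · exact (hBjc j₀).isPreconnected.subset_connectedComponentIn hvV hVU
  -- ### by transitivity, the translates of `W = V ∪ S j₀` cover `Z`
  have hcoverU : ∀ z ∈ U, ∃ m : ℤ, T m z ∈ Bj j₀ := fun z hz ↦ by
    obtain ⟨m, hm⟩ := htrans (T j₀ x) (hVU hvV) z hz
    exact ⟨m, hVcomp ▸ hm⟩
  set W : Set Z := Bj j₀ ∪ S j₀ with hW
  set F : ℤ → Set Z := fun m ↦ T m '' W with hF
  have hcover : ∀ z, ∃ m, z ∈ F m := fun z ↦ by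
    by_cases hz : z ∈ U
    · obtain ⟨m, hm⟩ := hcoverU z hz
      exact ⟨-m, T m z, Or.inl hm, hTneg m z⟩
    · have hz' : z ∈ ⋃ j, T j '' K := not_notMem.1 hz
      simp only [mem_iUnion] at hz'
      obtain ⟨l, k, hk, rfl⟩ := hz'
      refine ⟨l - j₀, T j₀ k, Or.inr ⟨k, hk, rfl⟩, ?_⟩
      rw [← hTadd, sub_add_cancel]
  -- ### `W` is closed and `h`-bounded; its translates are closed, disjoint, locally finite
  have hWcl : IsClosed W := by
    refine closure_subset_iff_isClosed.1 ?_
    rw [hW, closure_union, (hScl j₀).closure_eq]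
    exact union_subset hclV subset_union_right
  obtain ⟨a', b', hWbdd⟩ : ∃ a' b' : ℝ, W ⊆ h ⁻¹' Icc a' b' := by
    obtain ⟨cu, hcu⟩ := (hSc j₀).bddAbove_image hh.continuousOn
    obtain ⟨cl, hcl'⟩ := (hSc j₀).bddBelow_image hh.continuousOn
    refine ⟨min (a + j₀) cl, max (b + j₀) cu, ?_⟩
    rintro z (hz | hz)
    · have h1 := hBjbdd j₀ hz
      simp only [mem_preimage, mem_Icc] at h1 ⊢
      exact ⟨(min_le_left _ _).trans h1.1, h1.2.trans (le_max_left _ _)⟩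
    · exact ⟨(min_le_right _ _).trans (hcl' ⟨z, hz, rfl⟩),
        (hcu ⟨z, hz, rfl⟩).trans (le_max_right _ _)⟩
  have hFcl : ∀ m, IsClosed (F m) := fun m ↦ (T m).isClosed_image.2 hWcl
  have hFbdd : ∀ m, F m ⊆ h ⁻¹' Icc (a' + m) (b' + m) := fun m ↦ by
    rintro _ ⟨z, hz, rfl⟩
    have h1 := hWbdd hz
    simp only [mem_preimage, mem_Icc, hhT] at h1 ⊢
    constructor <;> linarith [h1.1, h1.2]
  have hF0 : F 0 = W := by
    show T 0 '' W = W
    rw [hT0', image_id]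
  -- a translate `S l` misses `Bj i` unless `l = i`
  have hSBj : ∀ i l, i ≠ l → Disjoint (S l) (Bj i) := fun i l hil ↦ by
    have h1 : S l = T (i - j₀) '' S (l - (i - j₀)) := by
      show T l '' K = T (i - j₀) '' (T (l - (i - j₀)) '' K)
      rw [himage, add_sub_cancel]
    have h2 : Bj i = T (i - j₀) '' Bj j₀ := by
      show T i '' B = T (i - j₀) '' (T j₀ '' B)
      rw [himage, sub_add_cancel]
    rw [h1, h2]
    refine (disjoint_image_iff (T _).injective).2 (hSV _ fun h3 ↦ hil ?_)
    linarith [h3]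
  have hBjBj : ∀ i l, i ≠ l → Disjoint (Bj i) (Bj l) := fun i l hil ↦
    disjoint_of_disjoint (hAjo i) (hBjo i) (hABj i) (hcovj i) (hclj i) (hBjo l) (hBjc l)
      (hBjuniv l) (hclj l) (hSdisj i l hil) (hSBj i l hil) (hSBj l i hil.symm)
  have hFm : ∀ m, F m = Bj (m + j₀) ∪ S (m + j₀) := fun m ↦ by
    show T m '' (T j₀ '' B ∪ T j₀ '' K) = T (m + j₀) '' B ∪ T (m + j₀) '' K
    rw [image_union, himage, himage]
  have hFdisj : ∀ m k, m ≠ k → Disjoint (F m) (F k) := fun m k hmk ↦ by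
    have hne : m + j₀ ≠ k + j₀ := fun h1 ↦ hmk (add_right_cancel h1)
    rw [hFm m, hFm k, disjoint_union_left, disjoint_union_right, disjoint_union_right]
    exact ⟨⟨hBjBj _ _ hne, (hSBj _ _ hne).symm⟩, hSBj _ _ hne.symm, hSdisj _ _ hne⟩
  have hFlf : LocallyFinite F := by
    intro z
    refine ⟨h ⁻¹' Ioo (h z - 1) (h z + 1), (isOpen_Ioo.preimage hh).mem_nhds (by simp), ?_⟩
    refine (finite_Ioo ⌊h z - 1 - b'⌋ ⌈h z + 1 - a'⌉).subset ?_
    rintro m ⟨w, hwF, hwI⟩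
    have hw := hFbdd m hwF
    simp only [mem_preimage, mem_Icc, mem_Ioo] at hw hwI
    refine ⟨Int.floor_lt.2 ?_, Int.lt_ceil.2 ?_⟩ <;> linarith [hw.1, hw.2, hwI.1, hwI.2]
  -- ### hence `W` is clopen, so `W = Z`, contradicting boundedness
  have hWc : Wᶜ = ⋃ m : {m : ℤ // m ≠ 0}, F m := by
    ext z
    simp only [mem_compl_iff, mem_iUnion]
    constructor
    · intro hz
      obtain ⟨m, hm⟩ := hcover z
      have hm0 : m ≠ 0 := by
        rintro rfl
        rw [hF0] at hm
        exact hz hm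
      exact ⟨⟨m, hm0⟩, hm⟩
    · rintro ⟨⟨m, hm0⟩, hm⟩ hzW
      rw [← hF0] at hzW
      exact (hFdisj m 0 hm0).ne_of_mem hm hzW rfl
  have hWopen : IsOpen W := by
    have h1 : IsClosed Wᶜ := by
      rw [hWc]
      exact (hFlf.comp_injective Subtype.val_injective).isClosed_iUnion fun i ↦ hFcl i
    simpa using h1.isOpen_compl
  have hWuniv : W = univ := IsClopen.eq_univ ⟨hWcl, hWopen⟩ ⟨T j₀ x, Or.inl hvV⟩
  obtain ⟨z, hz⟩ := hunbdd b'
  have h1 := hWbdd (hWuniv ▸ mem_univ z)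
  exact (not_le.2 hz) h1.2

end PeriodicSeparation

/-! ### §2 The cylinder `ℝ × Y → S¹ × Y` -/

namespace Cylinder

section Deck

variable {Y : Type*}

/-- Two points of the cylinder have the same image under `exp × id` iff they differ by a deck
translation `(t, y) ↦ (t + 2πm, y)`, `m ∈ ℤ`. [folklore] -/
theorem prodMap_exp_eq_iff (q q' : ℝ × Y) :
    Prod.map Circle.exp id q = Prod.map Circle.exp id q' ↔
      ∃ m : ℤ, q = (q'.1 + m * (2 * π), q'.2) := by
  obtain ⟨t, p⟩ := q
  obtain ⟨t', p'⟩ := q'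
  simp only [Prod.map_apply, id_eq, Prod.mk.injEq]
  constructor
  · rintro ⟨ht, rfl⟩
    obtain ⟨m, hm⟩ := Circle.exp_eq_exp.1 ht
    exact ⟨m, hm, rfl⟩
  · rintro ⟨m, hm, rfl⟩
    exact ⟨Circle.exp_eq_exp.2 ⟨m, hm⟩, rfl⟩

/-- The preimage under `exp × id` of the image of a set `K` is the union of the deck translates
of `K`. [folklore] -/
theorem preimage_image_eq_iUnion (K : Set (ℝ × Y)) :
    Prod.map Circle.exp id ⁻¹' (Prod.map Circle.exp id '' K) =
      ⋃ m : ℤ, (fun q : ℝ × Y ↦ ((q.1 + m * (2 * π), q.2) : ℝ × Y)) '' K := by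
  ext q
  simp only [mem_preimage, mem_image, mem_iUnion]
  constructor
  · rintro ⟨k, hk, hkq⟩
    obtain ⟨m, hm⟩ := (prodMap_exp_eq_iff q k).1 hkq.symm
    exact ⟨m, k, hk, hm.symm⟩
  · rintro ⟨m, k, hk, rfl⟩
    exact ⟨k, hk, ((prodMap_exp_eq_iff _ k).2 ⟨m, rfl⟩).symm⟩

end Deck

variable {Y : Type*} [TopologicalSpace Y]

/-- **Deck transitivity for the cylinder covering `exp × id : ℝ × Y → S¹ × Y`.**  If `U` is a
path connected subset of `S¹ × Y` and `x`, `y` lie over `U`, then some deck translate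
`(y₁ + 2πm, y₂)` of `y` lies in the connected component of `x` in the preimage of `U`: lift a
path of `U` from `π x` to `π y` starting at `x` (its first coordinate through the covering
`exp : ℝ → S¹`, its second coordinate verbatim); it ends over `π y`, i.e. at a deck translate
of `y`. [cite: HatcherAT2002, Prop. 1.30] -/
theorem exists_deck_mem_connectedComponentIn {U : Set (Circle × Y)} (hU : IsPathConnected U)
    {x y : ℝ × Y} (hx : Prod.map Circle.exp id x ∈ U) (hy : Prod.map Circle.exp id y ∈ U) :
    ∃ m : ℤ, ((y.1 + m * (2 * π), y.2) : ℝ × Y) ∈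
      connectedComponentIn (Prod.map Circle.exp id ⁻¹' U) x := by
  obtain ⟨γ, hγ⟩ := hU.joinedIn _ hx _ hy
  set γ₁ : C(unitInterval, Circle) := ⟨fun s ↦ (γ s).1, by fun_prop⟩ with hγ₁
  have h0 : γ₁ 0 = Circle.exp x.1 := by simp [hγ₁, γ.source]
  set Γ : C(unitInterval, ℝ) := Circle.isCoveringMap_exp.liftPath γ₁ x.1 h0 with hΓ
  have hΓlift : ∀ s, Circle.exp (Γ s) = γ₁ s := fun s ↦
    congr_fun (Circle.isCoveringMap_exp.liftPath_lifts γ₁ x.1 h0) s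
  have hΓ0 : Γ 0 = x.1 := Circle.isCoveringMap_exp.liftPath_zero γ₁ x.1 h0
  have h1 : Circle.exp (Γ 1) = Circle.exp y.1 := by
    rw [hΓlift]
    simp [hγ₁, γ.target]
  obtain ⟨m, hm⟩ := Circle.exp_eq_exp.1 h1
  refine ⟨m, ?_⟩
  let δ : Path x ((y.1 + m * (2 * π), y.2) : ℝ × Y) :=
    { toFun := fun s ↦ (Γ s, (γ s).2)
      continuous_toFun := by fun_prop
      source' := by
        refine Prod.ext hΓ0 ?_
        simp
      target' := by
        refine Prod.ext hm ?_
        simp }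
  have hδ : ∀ s, δ s ∈ Prod.map Circle.exp id ⁻¹' U := fun s ↦ by
    show (Circle.exp (Γ s), (γ s).2) ∈ U
    rw [hΓlift]
    exact hγ s
  exact (isPreconnected_range δ.continuous).subset_connectedComponentIn ⟨0, δ.source⟩
    (range_subset_iff.2 hδ) ⟨1, δ.target⟩

/-- **The periodic separation lemma for the cylinder.**  Over a compact, connected, locally path
connected `Y`, let `K ⊆ ℝ × Y` be compact and connected, disjoint from its deck translates
`(t, y) ↦ (t + 2πm, y)`, `m ≠ 0`, and such that the complement of its image in `S¹ × Y` is path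
connected.  Then no connected component of the complement of `K` is bounded in `t`.
[folklore] -/
theorem false_of_bddComponent [T2Space Y] [CompactSpace Y] [ConnectedSpace Y]
    [LocallyPathConnectedSpace Y] {K : Set (ℝ × Y)} (hK : IsCompact K) (hKc : IsConnected K)
    (hdisj : ∀ m : ℤ, m ≠ 0 →
      Disjoint K ((fun q : ℝ × Y ↦ ((q.1 + m * (2 * π), q.2) : ℝ × Y)) '' K))
    (hU : IsPathConnected (Prod.map Circle.exp id '' K)ᶜ)
    {x : ℝ × Y} (hx : x ∉ K) {a b : ℝ}
    (hbdd : connectedComponentIn Kᶜ x ⊆ Icc a b ×ˢ univ) : False := by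
  haveI : LocallyPathConnectedSpace (ℝ × Y) := locallyPathConnectedSpace_prod
  -- the deck transformations and the height `t / 2π`
  set T : ℤ → ℝ × Y ≃ₜ ℝ × Y := fun m ↦
    (Homeomorph.addRight ((m : ℝ) * (2 * π))).prodCongr (Homeomorph.refl Y) with hT
  have hTapply : ∀ (m : ℤ) (q : ℝ × Y), T m q = (q.1 + m * (2 * π), q.2) := fun m q ↦ rfl
  have hTfun : ∀ m : ℤ, ((T m : ℝ × Y ≃ₜ ℝ × Y) : ℝ × Y → ℝ × Y) =
      fun q : ℝ × Y ↦ ((q.1 + m * (2 * π), q.2) : ℝ × Y) := fun m ↦ funext (hTapply m)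
  have hπ : (0 : ℝ) < 2 * π := by positivity
  refine PeriodicSeparation.false_of_bddComponent T (fun z ↦ ?_) (fun i j z ↦ ?_)
    (fun q ↦ q.1 / (2 * π)) (by fun_prop) (fun j z ↦ ?_) (fun z V hV ↦ ?_) (fun a b ↦ ?_)
    hK hKc (fun j hj ↦ by rw [hTfun]; exact hdisj j hj) (fun x hx y hy ↦ ?_) hx
    (a := a / (2 * π)) (b := b / (2 * π)) (fun z hz ↦ ?_)
  · -- `T 0 = id`
    simp [hTapply]
  · -- `T (i + j) = T i ∘ T j`
    rw [hTapply, hTapply, hTapply]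
    push_cast
    ring_nf
  · -- `h ∘ T j = h + j`
    rw [hTapply]
    field_simp
  · -- no local maxima: move in the `t`-direction
    have hc : Continuous fun s : ℝ ↦ ((s, z.2) : ℝ × Y) := by fun_prop
    have hV' : (fun s : ℝ ↦ ((s, z.2) : ℝ × Y)) ⁻¹' V ∈ 𝓝 z.1 := hc.continuousAt.preimage_mem_nhds hV
    obtain ⟨ε, hε, hball⟩ := Metric.mem_nhds_iff.1 hV'
    refine ⟨(z.1 + ε / 2, z.2), hball ?_, ?_⟩
    · rw [Real.ball_eq_Ioo]
      constructor <;> linarith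
    · show z.1 / (2 * π) < (z.1 + ε / 2) / (2 * π)
      exact div_lt_div_of_pos_right (by linarith) hπ
  · -- properness: `h⁻¹[a, b] = [2πa, 2πb] × Y`
    have h1 : (fun q : ℝ × Y ↦ q.1 / (2 * π)) ⁻¹' Icc a b = Icc (a * (2 * π)) (b * (2 * π)) ×ˢ univ := by
      ext q
      simp only [mem_preimage, mem_Icc, mem_prod, mem_univ, and_true]
      rw [le_div_iff₀ hπ, div_le_iff₀ hπ]
    rw [h1]
    exact isCompact_Icc.prod isCompact_univ
  · -- deck transitivity
    have hx' : Prod.map Circle.exp id x ∈ (Prod.map Circle.exp id '' K)ᶜ := by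
      intro h1
      rw [← mem_preimage, preimage_image_eq_iUnion] at h1
      simp only [← hTfun] at h1
      exact hx h1
    have hy' : Prod.map Circle.exp id y ∈ (Prod.map Circle.exp id '' K)ᶜ := by
      intro h1
      rw [← mem_preimage, preimage_image_eq_iUnion] at h1
      simp only [← hTfun] at h1
      exact hy h1
    obtain ⟨m, hm⟩ := exists_deck_mem_connectedComponentIn hU hx' hy'
    refine ⟨m, ?_⟩
    rw [hTapply]
    convert hm using 2
    rw [preimage_compl, preimage_image_eq_iUnion]
    simp only [← hTfun]
  · -- boundedness of the component in terms of `h`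
    have h1 := hbdd hz
    simp only [mem_prod, mem_Icc, mem_univ, and_true] at h1
    simp only [mem_preimage, mem_Icc]
    exact ⟨div_le_div_of_nonneg_right h1.1 hπ.le, div_le_div_of_nonneg_right h1.2 hπ.le⟩

end Cylinder

/-! ### §3 The lift of a non-separating sphere of `S¹ × Sⁿ` -/

namespace BudneyGabai2019_thm_3_13

variable {n : ℕ}

/-- **No complementary component of the lift of a non-separating sphere is bounded.**  Let
`e : Sⁿ → S¹ × Sⁿ` (`n ≥ 1`) be a smooth embedding with connected complement and
`ẽ : Sⁿ → ℝ × Sⁿ` a continuous lift, `(exp × id) ∘ ẽ = e`.  Then no connected component of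
`ℝ × Sⁿ ∖ ẽ(Sⁿ)` is contained in a slab `[a, b] × Sⁿ`: the periodic separation lemma
(`Cylinder.false_of_bddComponent`) for the compact connected `ẽ(Sⁿ)`, whose deck translates are
disjoint from it (`disjoint_range_lift_deck`) and whose image `e(Sⁿ)` has (path) connected
complement.  This is the topological input of the proof of Thm. 3.13 (p. 22): the lifted sphere
separates the two ends of the cyclic cover. [cite: BudneyGabai2019, proof of Thm. 3.13] -/
theorem not_bdd_connectedComponentIn_compl_range_lift (hn : 1 ≤ n)
    {e : Metric.sphere (0 : EuclideanSpace ℝ (Fin (n + 1))) 1 →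
      Circle × Metric.sphere (0 : EuclideanSpace ℝ (Fin (n + 1))) 1}
    (he : Manifold.IsSmoothEmbedding (𝓡 n) ((𝓡 1).prod (𝓡 n)) ∞ e)
    (hconn : IsConnected (range e)ᶜ)
    {el : Metric.sphere (0 : EuclideanSpace ℝ (Fin (n + 1))) 1 →
      ℝ × Metric.sphere (0 : EuclideanSpace ℝ (Fin (n + 1))) 1}
    (hel : Continuous el) (hlift : Prod.map Circle.exp id ∘ el = e)
    {x : ℝ × Metric.sphere (0 : EuclideanSpace ℝ (Fin (n + 1))) 1} (hx : x ∉ range el)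
    {a b : ℝ} (hbdd : connectedComponentIn (range el)ᶜ x ⊆ Icc a b ×ˢ univ) : False := by
  -- `Sⁿ` is compact, connected (`n ≥ 1`) and locally path connected; so is `S¹`
  haveI : ConnectedSpace (Metric.sphere (0 : EuclideanSpace ℝ (Fin (n + 1))) 1) := by
    have hr : 1 < Module.rank ℝ (EuclideanSpace ℝ (Fin (n + 1))) :=
      Module.lt_rank_of_lt_finrank (by rw [finrank_euclideanSpace_fin]; omega)
    exact isConnected_iff_connectedSpace.1
      (isConnected_sphere hr (0 : EuclideanSpace ℝ (Fin (n + 1))) zero_le_one)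
  haveI : LocallyPathConnectedSpace (Metric.sphere (0 : EuclideanSpace ℝ (Fin (n + 1))) 1) :=
    ChartedSpace.locallyPathConnectedSpace (EuclideanSpace ℝ (Fin n)) _
  haveI : LocallyPathConnectedSpace Circle :=
    ChartedSpace.locallyPathConnectedSpace (EuclideanSpace ℝ (Fin 1)) _
  haveI : LocallyPathConnectedSpace
      (Circle × Metric.sphere (0 : EuclideanSpace ℝ (Fin (n + 1))) 1) :=
    locallyPathConnectedSpace_prod
  have hec : Continuous e := he.contMDiff.continuous
  -- the complement of `e(Sⁿ) = π(ẽ(Sⁿ))` is open and connected, hence path connected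
  have hU : IsPathConnected (Prod.map Circle.exp id '' range el)ᶜ := by
    rw [← range_comp, hlift]
    exact ((isCompact_range hec).isClosed.isOpen_compl.isConnected_iff_isPathConnected).1 hconn
  exact Cylinder.false_of_bddComponent (isCompact_range hel) (isConnected_range hel)
    (fun m hm ↦ disjoint_range_lift_deck he.isEmbedding.injective hlift hm) hU hx hbdd

/-- **A defining function of the lifted sphere has no bounded strict side.**  With `e`, `ẽ` as
above, let `G : ℝ × Sⁿ → ℝ` be continuous with `G = 0` exactly on `ẽ(Sⁿ)`, and let `σ ∈ ℝ`.
If the side `{σ G ≤ 0}` is bounded in `t`, then `{σ G < 0}` is empty: otherwise the complementary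
component of a point `q₀` with `σ G(q₀) < 0` stays inside `{σ G < 0}` (it cannot cross the
zero set `ẽ(Sⁿ)`), hence is bounded, contradicting
`not_bdd_connectedComponentIn_compl_range_lift`. [cite: BudneyGabai2019, proof of Thm. 3.13] -/
theorem false_of_sublevel_bdd (hn : 1 ≤ n)
    {e : Metric.sphere (0 : EuclideanSpace ℝ (Fin (n + 1))) 1 →
      Circle × Metric.sphere (0 : EuclideanSpace ℝ (Fin (n + 1))) 1}
    (he : Manifold.IsSmoothEmbedding (𝓡 n) ((𝓡 1).prod (𝓡 n)) ∞ e)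
    (hconn : IsConnected (range e)ᶜ)
    {el : Metric.sphere (0 : EuclideanSpace ℝ (Fin (n + 1))) 1 →
      ℝ × Metric.sphere (0 : EuclideanSpace ℝ (Fin (n + 1))) 1}
    (hel : Continuous el) (hlift : Prod.map Circle.exp id ∘ el = e)
    {G : ℝ × Metric.sphere (0 : EuclideanSpace ℝ (Fin (n + 1))) 1 → ℝ} (hG : Continuous G)
    (hG0 : ∀ q, G q = 0 ↔ q ∈ range el) {σ : ℝ}
    (hbdd : ∃ T : ℝ, ∀ q, σ * G q ≤ 0 → |q.1| ≤ T)
    {q₀ : ℝ × Metric.sphere (0 : EuclideanSpace ℝ (Fin (n + 1))) 1} (hq₀ : σ * G q₀ < 0) :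
    False := by
  obtain ⟨T, hT⟩ := hbdd
  have hq₀K : q₀ ∉ range el := fun h ↦ by
    rw [← hG0] at h
    rw [h, mul_zero] at hq₀
    exact lt_irrefl _ hq₀
  refine not_bdd_connectedComponentIn_compl_range_lift hn he hconn hel hlift hq₀K
    (a := -T) (b := T) ?_
  -- the component of `q₀` stays in `{σ G < 0}`
  have hsub : connectedComponentIn (range el)ᶜ q₀ ⊆ {q | σ * G q < 0} := by
    refine isPreconnected_connectedComponentIn.subset_right_of_subset_union
      (u := {q | 0 < σ * G q}) (v := {q | σ * G q < 0})
      (isOpen_lt continuous_const (continuous_const.mul hG))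
      (isOpen_lt (continuous_const.mul hG) continuous_const)
      (disjoint_left.2 fun q (h1 : 0 < σ * G q) (h2 : σ * G q < 0) ↦ lt_asymm h1 h2)
      (fun q hq ↦ ?_)
      ⟨q₀, mem_connectedComponentIn hq₀K, hq₀⟩
    have hqK : q ∉ range el := connectedComponentIn_subset _ _ hq
    have hGq : G q ≠ 0 := fun h ↦ hqK ((hG0 q).1 h)
    have hσ : σ ≠ 0 := by
      rintro rfl
      simp at hq₀
    rcases lt_or_gt_of_ne (mul_ne_zero hσ hGq) with h | h
    · exact Or.inr h
    · exact Or.inl h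
  intro q hq
  exact ⟨abs_le.1 (hT q (le_of_lt (hsub hq))), mem_univ _⟩

/-- **The end signs of a defining function of the lifted sphere are opposite.**  In the setting
of `NonSeparatingSpheresSideFunction.exists_sideFunction` — `G` smooth on `ℝ × Sⁿ`, vanishing
exactly on the lifted sphere `ẽ(Sⁿ)` of a *non-separating* smoothly embedded sphere `e`
(`n ≥ 1`), with `ker dG = dẽ(T Sⁿ)` along it, and end signs `σ₊`, `σ₋` for which
`{σ₊ G ≤ 0}` is bounded whenever `σ₊ σ₋ > 0` — one has **`σ₊ σ₋ < 0`**: the lifted sphere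
separates the two ends of the cylinder.  Indeed, if `σ₊ σ₋ > 0` the side `{σ₊ G < 0}` would be
bounded, hence empty (`false_of_sublevel_bdd`), so every point of `ẽ(Sⁿ)` would be a minimum of
`σ₊ G` and `dG` would vanish there (Fermat), whereas `ker dG = dẽ(T Sⁿ)` is a hyperplane.
[cite: BudneyGabai2019, proof of Thm. 3.13] -/
theorem sideFunction_signs_mul_neg (hn : 1 ≤ n)
    {e : Metric.sphere (0 : EuclideanSpace ℝ (Fin (n + 1))) 1 →
      Circle × Metric.sphere (0 : EuclideanSpace ℝ (Fin (n + 1))) 1}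
    (he : Manifold.IsSmoothEmbedding (𝓡 n) ((𝓡 1).prod (𝓡 n)) ∞ e)
    (hconn : IsConnected (range e)ᶜ)
    {el : Metric.sphere (0 : EuclideanSpace ℝ (Fin (n + 1))) 1 →
      ℝ × Metric.sphere (0 : EuclideanSpace ℝ (Fin (n + 1))) 1}
    (hel : Manifold.IsSmoothEmbedding (𝓡 n) (𝓘(ℝ, ℝ).prod (𝓡 n)) ∞ el)
    (hlift : Prod.map Circle.exp id ∘ el = e)
    {G : ℝ × Metric.sphere (0 : EuclideanSpace ℝ (Fin (n + 1))) 1 → ℝ}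
    (hGs : ContMDiff (𝓘(ℝ, ℝ).prod (𝓡 n)) 𝓘(ℝ, ℝ) ∞ G)
    (hG0 : ∀ q, G q = 0 ↔ q ∈ range el)
    (hker : ∀ (x : Metric.sphere (0 : EuclideanSpace ℝ (Fin (n + 1))) 1)
        (v : TangentSpace (𝓘(ℝ, ℝ).prod (𝓡 n)) (el x)),
      mfderiv (𝓘(ℝ, ℝ).prod (𝓡 n)) 𝓘(ℝ, ℝ) G (el x) v = 0 ↔
        v ∈ (mfderiv (𝓡 n) (𝓘(ℝ, ℝ).prod (𝓡 n)) el x).range)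
    {σp σm : ℝ} (hσp : σp ≠ 0) (hσm : σm ≠ 0)
    (hbdd : 0 < σp * σm → ∃ T : ℝ, ∀ q, σp * G q ≤ 0 → |q.1| ≤ T) : σp * σm < 0 := by
  by_contra hnot
  have hpos : 0 < σp * σm := lt_of_le_of_ne (not_lt.1 hnot) (mul_ne_zero hσp hσm).symm
  -- ### a point with `σp G < 0`: otherwise `dG = 0` along the lifted sphere
  obtain ⟨q₀, hq₀⟩ : ∃ q₀, σp * G q₀ < 0 := by
    by_contra hno
    push Not at hno
    -- a point of the sphere and the derivative of `G` there
    obtain ⟨x⟩ : Nonempty (Metric.sphere (0 : EuclideanSpace ℝ (Fin (n + 1))) 1) :=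
      (NormedSpace.sphere_nonempty.2 zero_le_one).to_subtype
    haveI : FiniteDimensional ℝ (TangentSpace (𝓘(ℝ, ℝ).prod (𝓡 n)) (el x)) :=
      inferInstanceAs (FiniteDimensional ℝ (ℝ × EuclideanSpace ℝ (Fin n)))
    haveI : FiniteDimensional ℝ (TangentSpace (𝓡 n) x) :=
      inferInstanceAs (FiniteDimensional ℝ (EuclideanSpace ℝ (Fin n)))
    set I := (𝓘(ℝ, ℝ).prod (𝓡 n) : ModelWithCorners ℝ (ℝ × EuclideanSpace ℝ (Fin n))
      (ModelProd ℝ (EuclideanSpace ℝ (Fin n)))) with hI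
    set L := mfderiv I 𝓘(ℝ, ℝ) G (el x) with hL
    -- `G ∘ chart⁻¹` has derivative `L` at the chart point, and a minimum there
    have hmd : MDifferentiableAt I 𝓘(ℝ, ℝ) G (el x) := hGs.mdifferentiableAt (by simp)
    have hfd : HasFDerivWithinAt (writtenInExtChartAt I 𝓘(ℝ, ℝ) (el x) G) L (range I)
        (extChartAt I (el x) (el x)) := hmd.hasMFDerivAt.2
    rw [ModelWithCorners.range_eq_univ, hasFDerivWithinAt_univ] at hfd
    have hfd' : HasFDerivAt (fun y ↦ σp * (G ∘ (extChartAt I (el x)).symm) y) (σp • L)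
        (extChartAt I (el x) (el x)) := by
      have h1 : writtenInExtChartAt I 𝓘(ℝ, ℝ) (el x) G = G ∘ (extChartAt I (el x)).symm := by
        ext y
        simp [writtenInExtChartAt]
      rw [h1] at hfd
      exact hfd.const_mul σp
    have hmin : IsLocalMin (fun y ↦ σp * (G ∘ (extChartAt I (el x)).symm) y)
        (extChartAt I (el x) (el x)) := by
      refine Filter.Eventually.of_forall fun y ↦ ?_
      have h0 : G (el x) = 0 := (hG0 _).2 ⟨x, rfl⟩
      simp only [comp_apply, extChartAt_to_inv, h0, mul_zero]
      exact hno _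
    have hL0 : L = 0 := (smul_eq_zero.1 (hmin.hasFDerivAt_eq_zero hfd')).resolve_left hσp
    -- so every tangent vector lies in `dẽ(T Sⁿ)`: dimension count
    set B := mfderiv (𝓡 n) I el x with hB
    have htop : LinearMap.range (B : TangentSpace (𝓡 n) x →ₗ[ℝ] TangentSpace I (el x)) = ⊤ := by
      rw [eq_top_iff]
      rintro v -
      exact (hker x v).1 (by rw [← hL, hL0]; rfl)
    have h1 := LinearMap.finrank_range_le (B : TangentSpace (𝓡 n) x →ₗ[ℝ] TangentSpace I (el x))
    rw [htop, finrank_top] at h1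
    change Module.finrank ℝ (ℝ × EuclideanSpace ℝ (Fin n)) ≤
      Module.finrank ℝ (EuclideanSpace ℝ (Fin n)) at h1
    rw [Module.finrank_prod, Module.finrank_self, finrank_euclideanSpace_fin] at h1
    omega
  exact false_of_sublevel_bdd hn he hconn hel.contMDiff.continuous hlift hGs.continuous hG0
    (hbdd hpos) hq₀

/-- **A separating defining function for the lift of a non-separating sphere.**  For a smoothly
embedded `n`-sphere `e : Sⁿ → S¹ × Sⁿ`, `n ≥ 1`, with connected complement, and a smoothly
embedded lift `ẽ` (`(exp × id) ∘ ẽ = e`; it exists for `n ≥ 2`, `exists_lift_isSmoothEmbedding`),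
there is a `C^∞` function `G : ℝ × Sⁿ → ℝ` vanishing exactly on `ẽ(Sⁿ)`, with
`ker dG = dẽ(T Sⁿ)` along it, **positive on `[T, ∞) × Sⁿ` and negative on `(-∞, -T] × Sⁿ`**
for some `T` (the defining function of `exists_sideFunction`, whose end signs are opposite by
`sideFunction_signs_mul_neg`, multiplied by `σ₊`).  In particular the two ends of the cylinder
lie in different complementary components of the lifted sphere.
[cite: BudneyGabai2019, proof of Thm. 3.13] -/
theorem exists_sideFunction_separating (hn : 1 ≤ n)
    {e : Metric.sphere (0 : EuclideanSpace ℝ (Fin (n + 1))) 1 →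
      Circle × Metric.sphere (0 : EuclideanSpace ℝ (Fin (n + 1))) 1}
    (he : Manifold.IsSmoothEmbedding (𝓡 n) ((𝓡 1).prod (𝓡 n)) ∞ e)
    (hconn : IsConnected (range e)ᶜ)
    {el : Metric.sphere (0 : EuclideanSpace ℝ (Fin (n + 1))) 1 →
      ℝ × Metric.sphere (0 : EuclideanSpace ℝ (Fin (n + 1))) 1}
    (hel : Manifold.IsSmoothEmbedding (𝓡 n) (𝓘(ℝ, ℝ).prod (𝓡 n)) ∞ el)
    (hlift : Prod.map Circle.exp id ∘ el = e) :
    ∃ G : ℝ × Metric.sphere (0 : EuclideanSpace ℝ (Fin (n + 1))) 1 → ℝ,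
      ContMDiff (𝓘(ℝ, ℝ).prod (𝓡 n)) 𝓘(ℝ, ℝ) ∞ G ∧
      (∀ q, G q = 0 ↔ q ∈ range el) ∧
      (∀ (x : Metric.sphere (0 : EuclideanSpace ℝ (Fin (n + 1))) 1)
          (v : TangentSpace (𝓘(ℝ, ℝ).prod (𝓡 n)) (el x)),
        mfderiv (𝓘(ℝ, ℝ).prod (𝓡 n)) 𝓘(ℝ, ℝ) G (el x) v = 0 ↔
          v ∈ (mfderiv (𝓡 n) (𝓘(ℝ, ℝ).prod (𝓡 n)) el x).range) ∧
      ∃ T : ℝ, (∀ q, T ≤ q.1 → 0 < G q) ∧ (∀ q, q.1 ≤ -T → G q < 0) := by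
  obtain ⟨G, hGs, hG0, hker, σp, σm, hσp, hσm, ⟨Tp, hTp⟩, ⟨Tm, hTm⟩, hbdd⟩ :=
    exists_sideFunction hn hel
  have hsign : σp * σm < 0 :=
    sideFunction_signs_mul_neg hn he hconn hel hlift hGs hG0 hker hσp hσm hbdd
  refine ⟨fun q ↦ σp * G q, contMDiff_const.mul hGs, fun q ↦ ?_, fun x v ↦ ?_,
    max Tp (-Tm), fun q hq ↦ hTp q ((le_max_left _ _).trans hq), fun q hq ↦ ?_⟩
  · show σp * G q = 0 ↔ q ∈ range el
    rw [← hG0 q]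
    exact ⟨fun h ↦ (mul_eq_zero.1 h).resolve_left hσp, fun h ↦ by rw [h, mul_zero]⟩
  · rw [← hker x v]
    have hmd : MDifferentiableAt (𝓘(ℝ, ℝ).prod (𝓡 n)) 𝓘(ℝ, ℝ) G (el x) :=
      hGs.mdifferentiableAt (by simp)
    have h2 := (hmd.hasMFDerivAt.const_smul σp).mfderiv
    have h4 : (fun q ↦ σp * G q) = σp • G := rfl
    rw [h4, h2]
    show σp • (mfderiv (𝓘(ℝ, ℝ).prod (𝓡 n)) 𝓘(ℝ, ℝ) G (el x) v) = 0 ↔ _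
    rw [smul_eq_zero]
    exact ⟨fun h ↦ h.resolve_left hσp, Or.inr⟩
  · -- towards `-∞`: `σm G > 0` and `σp σm < 0` give `σp G < 0`
    have h1 : 0 < σm * G q := hTm q (by linarith [le_max_right Tp (-Tm)])
    nlinarith [h1, hsign, mul_pos (mul_self_pos.2 hσm) (mul_self_pos.2 hσp)]

end BudneyGabai2019_thm_3_13

end Literature.Topology.FourManifolds

end
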